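import Summits.Ventures.PercRepro.C025ProfilePLDSixLiftArith

/-!
# THE RANK-5 UNIFORM MATROID U_{5,m} FOR EVERY m ≥ 9 FROM THE CASE m = 9 AND THE EXACT RANK-8 PRESERVERS: THE ARITHMETIC (night-3 g34)

`proofs/NIGHT3-G34-FASTLIFT.md` §2 (the rank-≤ 7 version is `C025ProfilePLDFiveLiftArith`, g32).  The profile of `U_{5,m}`, `m ≥ 9`,
has 11 layers (`sum_choose_min_five_eight`, `c_m = Σ_{5 ≤ i ≤ m−5} C(m,i)` non-decreasing).  At rank ≤ 8 the exact joint-LP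
preservers are q₅ = T₁₅ + 3·T₂₅ + 5·T₃₅ + 7·T₄₅, q₅′ = T₂₅ + 2·T₃₅ + 3·T₄₅ and q₅″ = T₃₅ + 3·T₄₅ (kit j321189: T₃₅ + 2·T₄₅ is
infeasible at (9, 9, 1)); with the base `m₀ = 9` the `T₄₅`-coefficient of the lift identity is `k(k³ + 18k² + 83k − 54)`, not a
polynomial with nonnegative coefficients, so the case `m = 9` is split off and the identity is stated from `m = 10 + k`:
`24·(U_{5,10+k} − U_{5,9}) = (24 + 24k)·q₅ + (144 + 156k + 12k²)·q₅′ + (456 + 536k + 84k² + 4k³)·q₅″ + (48 + 170k + 143k² + 22k³ + k⁴)·T₄₅ + 24(c_m − c_9)·δ₅₅`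
(`lift_alg_five_eight`; `choose_*_ten_eight` are `24·C(10+k, j)`).  `T₄₅` and `δ₅₅` preserve PER-LAYER DOMINANCE (g29), the `q`'s do at
rank ≤ 8 (certificate tables); hence the lift `lift_instance_five_eight` for every `9 ≤ m` (`m = 9` is the base instance itself).
No `def`, no `instance`, no notation.  Axioms: standard.
-/

namespace PercRepro

open Finset

namespace PLDFiveLift

variable {ι : Type}

/-- The uniform profile of `U_{5,m}`, `m ≥ 9`: 11 layers. -/
theorem sum_choose_min_five_eight (m : ℕ) (hm : 9 ≤ m) (g : ℕ → ℕ → ℕ) :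
    ∑ i ∈ range (m + 1), m.choose i * g (min i 5) (min (m - i) 5) =
      g 0 5 + m * g 1 5 + m.choose 2 * g 2 5 + m.choose 3 * g 3 5 + m.choose 4 * g 4 5 + (∑ i ∈ Ico 5 (m - 4), m.choose i) * g 5 5 + m.choose 4 * g 5 4 + m.choose 3 * g 5 3 + m.choose 2 * g 5 2 + m * g 5 1 + g 5 0 := by
  obtain ⟨k, rfl⟩ : ∃ k, m = k + 9 := ⟨m - 9, by omega⟩
  rw [sum_range_succ, sum_range_succ, sum_range_succ, sum_range_succ, sum_range_succ, sum_range_succ', sum_range_succ', sum_range_succ', sum_range_succ', sum_range_succ']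
  have hmid : ∀ i ∈ range k, (k + 9).choose (i + 1 + 1 + 1 + 1 + 1) * g (min (i + 1 + 1 + 1 + 1 + 1) 5)
      (min (k + 9 - (i + 1 + 1 + 1 + 1 + 1)) 5) = (k + 9).choose (i + 1 + 1 + 1 + 1 + 1) * g 5 5 := by
    intro i hi
    rw [mem_range] at hi
    rw [show min (i + 1 + 1 + 1 + 1 + 1) 5 = 5 by omega,
      show min (k + 9 - (i + 1 + 1 + 1 + 1 + 1)) 5 = 5 by omega]
  rw [sum_congr rfl hmid, ← sum_mul, show k + 9 - 4 = k + 5 by omega, sum_Ico_eq_sum_range,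
    show k + 5 - 5 = k by omega]
  have hc : ∑ i ∈ range k, (k + 9).choose (5 + i) = ∑ i ∈ range k, (k + 9).choose (i + 1 + 1 + 1 + 1 + 1) :=
    sum_congr rfl fun i _ => by rw [show 5 + i = i + 1 + 1 + 1 + 1 + 1 by omega]
  have h1 : (k + 9).choose (0 + 1) = k + 9 := Nat.choose_one_right _
  have h1' : (k + 9).choose (k + 8) = k + 9 := Nat.choose_succ_self_right (k + 8)
  have h2 : (k + 9).choose (k + 7) = (k + 9).choose 2 := by
    rw [← Nat.choose_symm (by omega : 2 ≤ k + 9), show k + 9 - 2 = k + 7 by omega]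
  have h3 : (k + 9).choose (k + 6) = (k + 9).choose 3 := by
    rw [← Nat.choose_symm (by omega : 3 ≤ k + 9), show k + 9 - 3 = k + 6 by omega]
  have h4 : (k + 9).choose (k + 5) = (k + 9).choose 4 := by
    rw [← Nat.choose_symm (by omega : 4 ≤ k + 9), show k + 9 - 4 = k + 5 by omega]
  rw [hc, Nat.choose_zero_right, Nat.choose_self, h1, h1', h2, h3, h4]
  simp only [show min (0 + 1) 5 = 1 by omega, show min (0 + 1 + 1) 5 = 2 by omega, show min (0 + 1 + 1 + 1) 5 = 3 by omega, show min (0 + 1 + 1 + 1 + 1) 5 = 4 by omega, show min (k + 8) 5 = 5 by omega, show min (k + 7) 5 = 5 by omega, show min (k + 6) 5 = 5 by omega, show min (k + 5) 5 = 5 by omega, show k + 9 - (k + 8) = 1 by omega, show k + 9 - (k + 7) = 2 by omega, show k + 9 - (k + 6) = 3 by omega, show k + 9 - (k + 5) = 4 by omega, show min (k + 9 - (0 + 1)) 5 = 5 by omega, show min (k + 9 - (0 + 1 + 1)) 5 = 5 by omega, show min (k + 9 - (0 + 1 + 1 + 1)) 5 = 5 by omega, show min 0 5 = 0 by omega, show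 k + 9 - 0 = k + 9 by omega, show min (k + 9) 5 = 5 by omega, show k + 9 - (k + 9) = 0 by omega, one_mul]
  ring

/-- `c_{m₀} ≤ c_m` for `m₀ ≤ m`. -/
theorem sum_choose_mid5_mono_eight (m₀ m : ℕ) (hm : m₀ ≤ m) :
    ∑ i ∈ Ico 5 (m₀ - 4), m₀.choose i ≤ ∑ i ∈ Ico 5 (m - 4), m.choose i := by
  calc ∑ i ∈ Ico 5 (m₀ - 4), m₀.choose i ≤ ∑ i ∈ Ico 5 (m₀ - 4), m.choose i :=
        sum_le_sum fun i _ => Nat.choose_le_choose i hm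
    _ ≤ ∑ i ∈ Ico 5 (m - 4), m.choose i :=
        sum_le_sum_of_subset_of_nonneg (Ico_subset_Ico le_rfl (by omega)) fun _ _ _ => Nat.zero_le _

/-- `24·C(m,4) = m * (m - 1) * (m - 2) * (m - 3)`. -/
theorem fact_mul_choose_4 (m : ℕ) :
    24 * m.choose 4 = m * (m - 1) * (m - 2) * (m - 3) := by
  rcases m with _ | n
  · rfl
  · have h := Nat.add_one_mul_choose_eq n 3
    have hp := PLDSolidLift.six_mul_choose_three n
    calc 24 * (n + 1).choose 4 = 6 * ((n + 1).choose (3 + 1) * (3 + 1)) := by ring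
      _ = 6 * ((n + 1) * n.choose 3) := by rw [h]
      _ = (n + 1) * (6 * n.choose 3) := by ring
      _ = (n + 1) * (n * (n - 1) * (n - 2)) := by rw [hp]
      _ = (n + 1) * (n + 1 - 1) * (n + 1 - 2) * (n + 1 - 3) := by
          rcases n with _ | n
          · rfl
          · rcases n with _ | n
            · rfl
            · rcases n with _ | n
              · rfl
              · rw [show n + 1 + 1 + 1 + 1 - 1 = n + 3 by omega, show n + 1 + 1 + 1 + 1 - 2 = n + 2 by omega, show n + 1 + 1 + 1 + 1 - 3 = n + 1 by omega, show n + 1 + 1 + 1 - 1 = n + 2 by omega, show n + 1 + 1 + 1 - 2 = n + 1 by omega]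
                ring

/-- `24·C(10+k, 2) = 1080 + 228 * k + 12 * k * k`. -/
theorem choose_two_ten_eight (k : ℕ) : 24 * (10 + k).choose 2 = 1080 + 228 * k + 12 * k * k := by
  have h := PLDSolidLift.two_mul_choose_two (10 + k)
  rw [show 10 + k - 1 = 9 + k by omega] at h
  nlinarith [h]

/-- `24·C(10+k, 3) = 2880 + 968 * k + 108 * k * k + 4 * k * k * k`. -/
theorem choose_three_ten_eight (k : ℕ) : 24 * (10 + k).choose 3 = 2880 + 968 * k + 108 * k * k + 4 * k * k * k := by
  have h := PLDSolidLift.six_mul_choose_three (10 + k)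
  rw [show 10 + k - 1 = 9 + k by omega, show 10 + k - 2 = 8 + k by omega] at h
  nlinarith [h]

/-- `24·C(10+k, 4) = 5040 + 2414 * k + 431 * k * k + 34 * k * k * k + k * k * k * k`. -/
theorem choose_four_ten_eight (k : ℕ) : 24 * (10 + k).choose 4 = 5040 + 2414 * k + 431 * k * k + 34 * k * k * k + k * k * k * k := by
  have h := PLDFiveLift.twentyfour_mul_choose_four (10 + k)
  rw [show 10 + k - 1 = 9 + k by omega, show 10 + k - 2 = 8 + k by omega, show 10 + k - 3 = 7 + k by omega] at h
  nlinarith [h]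

/-- The linear algebra of the rank-5 lift from `m₀ = 9`, with the layer sums and the coefficients abstracted. -/
theorem lift_alg_five_eight (a05 a15 a25 a35 a45 a55 a54 a53 a52 a51 a50
    b05 b15 b25 b35 b45 b55 b54 b53 b52 b51 b50 k k' C2 C3 C4 c₀ : ℕ)
    (hC2 : 24 * C2 = 1080 + 228 * k + 12 * k * k)
    (hC3 : 24 * C3 = 2880 + 968 * k + 108 * k * k + 4 * k * k * k)
    (hC4 : 24 * C4 = 5040 + 2414 * k + 431 * k * k + 34 * k * k * k + k * k * k * k)
    (h₀ : a05 + 9 * a15 + 36 * a25 + 84 * a35 + 126 * a45 + c₀ * a55 + 126 * a54 + 84 * a53 + 36 * a52 + 9 * a51 + a50 ≤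
      b05 + 9 * b15 + 36 * b25 + 84 * b35 + 126 * b45 + c₀ * b55 + 126 * b54 + 84 * b53 + 36 * b52 + 9 * b51 + b50)
    (hq : (a15 + a51) + 3 * (a25 + a52) + 5 * (a35 + a53) + 7 * (a45 + a54) ≤ (b15 + b51) + 3 * (b25 + b52) + 5 * (b35 + b53) + 7 * (b45 + b54))
    (hq' : (a25 + a52) + 2 * (a35 + a53) + 3 * (a45 + a54) ≤ (b25 + b52) + 2 * (b35 + b53) + 3 * (b45 + b54))
    (hq'' : (a35 + a53) + 3 * (a45 + a54) ≤ (b35 + b53) + 3 * (b45 + b54))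
    (hT : a45 + a54 ≤ b45 + b54) (hS : a55 ≤ b55) :
    a05 + (10 + k) * a15 + C2 * a25 + C3 * a35 + C4 * a45 + (c₀ + k') * a55 + C4 * a54 + C3 * a53 + C2 * a52 + (10 + k) * a51 + a50 ≤
      b05 + (10 + k) * b15 + C2 * b25 + C3 * b35 + C4 * b45 + (c₀ + k') * b55 + C4 * b54 + C3 * b53 + C2 * b52 + (10 + k) * b51 + b50 := by
  have eC2a25 : 24 * C2 * a25 = (1080 + 228 * k + 12 * k * k) * a25 := by rw [hC2]
  have eC2a52 : 24 * C2 * a52 = (1080 + 228 * k + 12 * k * k) * a52 := by rw [hC2]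
  have eC2b25 : 24 * C2 * b25 = (1080 + 228 * k + 12 * k * k) * b25 := by rw [hC2]
  have eC2b52 : 24 * C2 * b52 = (1080 + 228 * k + 12 * k * k) * b52 := by rw [hC2]
  have eC3a35 : 24 * C3 * a35 = (2880 + 968 * k + 108 * k * k + 4 * k * k * k) * a35 := by rw [hC3]
  have eC3a53 : 24 * C3 * a53 = (2880 + 968 * k + 108 * k * k + 4 * k * k * k) * a53 := by rw [hC3]
  have eC3b35 : 24 * C3 * b35 = (2880 + 968 * k + 108 * k * k + 4 * k * k * k) * b35 := by rw [hC3]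
  have eC3b53 : 24 * C3 * b53 = (2880 + 968 * k + 108 * k * k + 4 * k * k * k) * b53 := by rw [hC3]
  have eC4a45 : 24 * C4 * a45 = (5040 + 2414 * k + 431 * k * k + 34 * k * k * k + k * k * k * k) * a45 := by rw [hC4]
  have eC4a54 : 24 * C4 * a54 = (5040 + 2414 * k + 431 * k * k + 34 * k * k * k + k * k * k * k) * a54 := by rw [hC4]
  have eC4b45 : 24 * C4 * b45 = (5040 + 2414 * k + 431 * k * k + 34 * k * k * k + k * k * k * k) * b45 := by rw [hC4]
  have eC4b54 : 24 * C4 * b54 = (5040 + 2414 * k + 431 * k * k + 34 * k * k * k + k * k * k * k) * b54 := by rw [hC4]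
  have hqk := Nat.mul_le_mul_left ((24 + 24 * k)) hq
  have hq'k := Nat.mul_le_mul_left ((144 + 156 * k + 12 * k * k)) hq'
  have hq''k := Nat.mul_le_mul_left ((456 + 536 * k + 84 * k * k + 4 * k * k * k)) hq''
  have hTk := Nat.mul_le_mul_left ((48 + 170 * k + 143 * k * k + 22 * k * k * k + k * k * k * k)) hT
  have hSk := Nat.mul_le_mul_left (24 * k') hS
  linarith [eC2a25, eC2a52, eC2b25, eC2b52, eC3a35, eC3a53, eC3b35, eC3b53, eC4a45, eC4a54, eC4b45, eC4b54, hqk, hq'k, hq''k, hTk, hSk, h₀]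

/-- THE LIFT IN `m` FOR `U_{5,m}` from `m₀ = 9`: for a family `(s, x, f)` with (PLD), `9 ≤ m`, an admissible `(lo, hi, δ, Θ)`,
the preserver instances and the `U_{5,9}`-instance give the `U_{5,m}`-instance. -/
theorem lift_instance_five_eight (s : Finset ι) (x f : ι → ℕ)
    (hPLD : ∀ lo hi δ Θ : ℕ, Θ ≤ lo + hi + δ → (lo = 0 ∨ lo + hi + δ ≤ Θ) →
      ∑ i ∈ s, (if lo ≤ x i ∧ x i ≤ hi ∧ Θ ≤ f i + x i then (f i).choose δ else 0) ≤
        ∑ i ∈ s, (if lo + δ ≤ f i ∧ f i ≤ hi + δ then (f i).choose δ else 0))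
    (m : ℕ) (hm : 9 ≤ m) (lo hi δ Θ : ℕ) (hΘ : Θ ≤ lo + hi + δ) (hlo : lo = 0 ∨ lo + hi + δ ≤ Θ)
    (hq : ∑ i ∈ s, (((if lo ≤ x i + 1 ∧ x i + 1 ≤ hi ∧ Θ ≤ (f i + 5) + (x i + 1) then (f i + 5).choose δ else 0) + (if lo ≤ x i + 5 ∧ x i + 5 ≤ hi ∧ Θ ≤ (f i + 1) + (x i + 5) then (f i + 1).choose δ else 0)) + 3 * ((if lo ≤ x i + 2 ∧ x i + 2 ≤ hi ∧ Θ ≤ (f i + 5) + (x i + 2) then (f i + 5).choose δ else 0) + (if lo ≤ x i + 5 ∧ x i + 5 ≤ hi ∧ Θ ≤ (f i + 2) + (x i + 5) then (f i + 2).choose δ else 0)) + 5 * ((if lo ≤ x i + 3 ∧ x i + 3 ≤ hi ∧ Θ ≤ (f i + 5) + (x i + 3) then (f i + 5).choose δ else 0) + (if lo ≤ x i + 5 ∧ x i + 5 ≤ hi ∧ Θ ≤ (f i + 3) + (x i + 5) then (f i + 3).choose δ else 0)) + 7 * ((if lo ≤ x i + 4 ∧ x i + 4 ≤ hi ∧ Θ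 ≤ (f i + 5) + (x i + 4) then (f i + 5).choose δ else 0) + (if lo ≤ x i + 5 ∧ x i + 5 ≤ hi ∧ Θ ≤ (f i + 4) + (x i + 5) then (f i + 4).choose δ else 0))) ≤ ∑ i ∈ s, (((if lo + δ ≤ f i + 5 ∧ f i + 5 ≤ hi + δ then (f i + 5).choose δ else 0) + (if lo + δ ≤ f i + 1 ∧ f i + 1 ≤ hi + δ then (f i + 1).choose δ else 0)) + 3 * ((if lo + δ ≤ f i + 5 ∧ f i + 5 ≤ hi + δ then (f i + 5).choose δ else 0) + (if lo + δ ≤ f i + 2 ∧ f i + 2 ≤ hi + δ then (f i + 2).choose δ else 0)) + 5 * ((if lo + δ ≤ f i + 5 ∧ f i + 5 ≤ hi + δ then (f i + 5).choose δ else 0) + (if lo + δ ≤ f i + 3 ∧ f i + 3 ≤ hi + δ then (f i + 3).choose δ else 0)) + 7 * ((if lo + δ ≤ f i + 5 ∧ f i + 5 ≤ hi + δ then (f i + 5).choose δ else 0) + (if lo + δ ≤ f i + 4 ∧ f i + 4 ≤ hi + δ then (f i + 4).choose δ else 0))))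
    (hq' : ∑ i ∈ s, (((if lo ≤ x i + 2 ∧ x i + 2 ≤ hi ∧ Θ ≤ (f i + 5) + (x i + 2) then (f i + 5).choose δ else 0) + (if lo ≤ x i + 5 ∧ x i + 5 ≤ hi ∧ Θ ≤ (f i + 2) + (x i + 5) then (f i + 2).choose δ else 0)) + 2 * ((if lo ≤ x i + 3 ∧ x i + 3 ≤ hi ∧ Θ ≤ (f i + 5) + (x i + 3) then (f i + 5).choose δ else 0) + (if lo ≤ x i + 5 ∧ x i + 5 ≤ hi ∧ Θ ≤ (f i + 3) + (x i + 5) then (f i + 3).choose δ else 0)) + 3 * ((if lo ≤ x i + 4 ∧ x i + 4 ≤ hi ∧ Θ ≤ (f i + 5) + (x i + 4) then (f i + 5).choose δ else 0) + (if lo ≤ x i + 5 ∧ x i + 5 ≤ hi ∧ Θ ≤ (f i + 4) + (x i + 5) then (f i + 4).choose δ else 0))) ≤ ∑ i ∈ s, (((if lo + δ ≤ f i + 5 ∧ f i + 5 ≤ hi + δ then (f i + 5).choose δ else 0) + (if lo + δ ≤ f i + 2 ∧ f i + 2 ≤ hi + δ then (f i + 2).choose δ else 0)) + 2 * ((if lo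 + δ ≤ f i + 5 ∧ f i + 5 ≤ hi + δ then (f i + 5).choose δ else 0) + (if lo + δ ≤ f i + 3 ∧ f i + 3 ≤ hi + δ then (f i + 3).choose δ else 0)) + 3 * ((if lo + δ ≤ f i + 5 ∧ f i + 5 ≤ hi + δ then (f i + 5).choose δ else 0) + (if lo + δ ≤ f i + 4 ∧ f i + 4 ≤ hi + δ then (f i + 4).choose δ else 0))))
    (hq'' : ∑ i ∈ s, (((if lo ≤ x i + 3 ∧ x i + 3 ≤ hi ∧ Θ ≤ (f i + 5) + (x i + 3) then (f i + 5).choose δ else 0) + (if lo ≤ x i + 5 ∧ x i + 5 ≤ hi ∧ Θ ≤ (f i + 3) + (x i + 5) then (f i + 3).choose δ else 0)) + 3 * ((if lo ≤ x i + 4 ∧ x i + 4 ≤ hi ∧ Θ ≤ (f i + 5) + (x i + 4) then (f i + 5).choose δ else 0) + (if lo ≤ x i + 5 ∧ x i + 5 ≤ hi ∧ Θ ≤ (f i + 4) + (x i + 5) then (f i + 4).choose δ else 0))) ≤ ∑ i ∈ s, (((if lo + δ ≤ f i + 5 ∧ f i + 5 ≤ hi + δ then (f i + 5).choose δ else 0)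 + (if lo + δ ≤ f i + 3 ∧ f i + 3 ≤ hi + δ then (f i + 3).choose δ else 0)) + 3 * ((if lo + δ ≤ f i + 5 ∧ f i + 5 ≤ hi + δ then (f i + 5).choose δ else 0) + (if lo + δ ≤ f i + 4 ∧ f i + 4 ≤ hi + δ then (f i + 4).choose δ else 0))))
    (h₀ : ∑ i ∈ s, ∑ j ∈ range (9 + 1), Nat.choose 9 j *
        (if lo ≤ x i + min j 5 ∧ x i + min j 5 ≤ hi ∧ Θ ≤ (f i + min (9 - j) 5) + (x i + min j 5) then
          (f i + min (9 - j) 5).choose δ else 0) ≤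
      ∑ i ∈ s, ∑ j ∈ range (9 + 1), Nat.choose 9 j *
        (if lo + δ ≤ f i + min (9 - j) 5 ∧ f i + min (9 - j) 5 ≤ hi + δ then (f i + min (9 - j) 5).choose δ else 0)) :
    ∑ i ∈ s, ∑ j ∈ range (m + 1), Nat.choose m j *
        (if lo ≤ x i + min j 5 ∧ x i + min j 5 ≤ hi ∧ Θ ≤ (f i + min (m - j) 5) + (x i + min j 5) then
          (f i + min (m - j) 5).choose δ else 0) ≤
      ∑ i ∈ s, ∑ j ∈ range (m + 1), Nat.choose m j *
        (if lo + δ ≤ f i + min (m - j) 5 ∧ f i + min (m - j) 5 ≤ hi + δ then (f i + min (m - j) 5).choose δ else 0) := by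
  -- the preservers `T_{4,5}` and `δ_{55}`
  have h11 : ∀ lo hi δ Θ : ℕ, Θ ≤ lo + hi + δ → (lo = 0 ∨ lo + hi + δ ≤ Θ) →
      ∑ i ∈ s, (if lo ≤ x i + 1 ∧ x i + 1 ≤ hi ∧ Θ ≤ (f i + 1) + (x i + 1) then (f i + 1).choose δ else 0) ≤
        ∑ i ∈ s, (if lo + δ ≤ f i + 1 ∧ f i + 1 ≤ hi + δ then (f i + 1).choose δ else 0) :=
    fun lo hi δ Θ h1 h2 => PLDClosure.shift11 s x f hPLD lo hi δ Θ h1 h2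
  have h22 : ∀ lo hi δ Θ : ℕ, Θ ≤ lo + hi + δ → (lo = 0 ∨ lo + hi + δ ≤ Θ) →
      ∑ i ∈ s, (if lo ≤ x i + 2 ∧ x i + 2 ≤ hi ∧ Θ ≤ (f i + 2) + (x i + 2) then (f i + 2).choose δ else 0) ≤
        ∑ i ∈ s, (if lo + δ ≤ f i + 2 ∧ f i + 2 ≤ hi + δ then (f i + 2).choose δ else 0) :=
    fun lo hi δ Θ h1 h2 => PLDClosure.shift11 s (fun i => x i + 1) (fun i => f i + 1) h11 lo hi δ Θ h1 h2
  have h33 : ∀ lo hi δ Θ : ℕ, Θ ≤ lo + hi + δ → (lo = 0 ∨ lo + hi + δ ≤ Θ) →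
      ∑ i ∈ s, (if lo ≤ x i + 3 ∧ x i + 3 ≤ hi ∧ Θ ≤ (f i + 3) + (x i + 3) then (f i + 3).choose δ else 0) ≤
        ∑ i ∈ s, (if lo + δ ≤ f i + 3 ∧ f i + 3 ≤ hi + δ then (f i + 3).choose δ else 0) :=
    fun lo hi δ Θ h1 h2 => PLDClosure.shift11 s (fun i => x i + 2) (fun i => f i + 2) h22 lo hi δ Θ h1 h2
  have h44 : ∀ lo hi δ Θ : ℕ, Θ ≤ lo + hi + δ → (lo = 0 ∨ lo + hi + δ ≤ Θ) →
      ∑ i ∈ s, (if lo ≤ x i + 4 ∧ x i + 4 ≤ hi ∧ Θ ≤ (f i + 4) + (x i + 4) then (f i + 4).choose δ else 0) ≤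
        ∑ i ∈ s, (if lo + δ ≤ f i + 4 ∧ f i + 4 ≤ hi + δ then (f i + 4).choose δ else 0) :=
    fun lo hi δ Θ h1 h2 => PLDClosure.shift11 s (fun i => x i + 3) (fun i => f i + 3) h33 lo hi δ Θ h1 h2
  have hT : ∑ i ∈ s, ((if lo ≤ x i + 4 ∧ x i + 4 ≤ hi ∧ Θ ≤ (f i + 5) + (x i + 4) then (f i + 5).choose δ else 0) + (if lo ≤ x i + 5 ∧ x i + 5 ≤ hi ∧ Θ ≤ (f i + 4) + (x i + 5) then (f i + 4).choose δ else 0)) ≤ ∑ i ∈ s, ((if lo + δ ≤ f i + 5 ∧ f i + 5 ≤ hi + δ then (f i + 5).choose δ else 0) + (if lo + δ ≤ f i + 4 ∧ f i + 4 ≤ hi + δ then (f i + 4).choose δ else 0)) :=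
    PLDClosure.coloop s (fun i => x i + 4) (fun i => f i + 4) h44 lo hi δ Θ hΘ hlo
  have hS : ∑ i ∈ s, (if lo ≤ x i + 5 ∧ x i + 5 ≤ hi ∧ Θ ≤ (f i + 5) + (x i + 5) then (f i + 5).choose δ else 0) ≤ ∑ i ∈ s, (if lo + δ ≤ f i + 5 ∧ f i + 5 ≤ hi + δ then (f i + 5).choose δ else 0) :=
    PLDClosure.shift11 s (fun i => x i + 4) (fun i => f i + 4) h44 lo hi δ Θ hΘ hlo
  -- the layers, for `m` and for `9`
  have hLm : ∀ n : ℕ, 9 ≤ n → ∀ i ∈ s, ∑ j ∈ range (n + 1), Nat.choose n j *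
        (if lo ≤ x i + min j 5 ∧ x i + min j 5 ≤ hi ∧ Θ ≤ (f i + min (n - j) 5) + (x i + min j 5) then
          (f i + min (n - j) 5).choose δ else 0) =
      (if lo ≤ x i ∧ x i ≤ hi ∧ Θ ≤ (f i + 5) + (x i) then (f i + 5).choose δ else 0) + n * (if lo ≤ x i + 1 ∧ x i + 1 ≤ hi ∧ Θ ≤ (f i + 5) + (x i + 1) then (f i + 5).choose δ else 0) + n.choose 2 * (if lo ≤ x i + 2 ∧ x i + 2 ≤ hi ∧ Θ ≤ (f i + 5) + (x i + 2) then (f i + 5).choose δ else 0) + n.choose 3 * (if lo ≤ x i + 3 ∧ x i + 3 ≤ hi ∧ Θ ≤ (f i + 5) + (x i + 3) then (f i + 5).choose δ else 0) + n.choose 4 * (if lo ≤ x i + 4 ∧ x i + 4 ≤ hi ∧ Θ ≤ (f i + 5) + (x i + 4) then (f i + 5).choose δ else 0) + (∑ i ∈ Ico 5 (n - 4), n.choose i) * (if lo ≤ x i + 5 ∧ x i + 5 ≤ hi ∧ Θ ≤ (f i + 5) + (x i + 5) then (f i + 5).choose δ else 0) + n.choose 4 * (if lo ≤ x i + 5 ∧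 x i + 5 ≤ hi ∧ Θ ≤ (f i + 4) + (x i + 5) then (f i + 4).choose δ else 0) + n.choose 3 * (if lo ≤ x i + 5 ∧ x i + 5 ≤ hi ∧ Θ ≤ (f i + 3) + (x i + 5) then (f i + 3).choose δ else 0) + n.choose 2 * (if lo ≤ x i + 5 ∧ x i + 5 ≤ hi ∧ Θ ≤ (f i + 2) + (x i + 5) then (f i + 2).choose δ else 0) + n * (if lo ≤ x i + 5 ∧ x i + 5 ≤ hi ∧ Θ ≤ (f i + 1) + (x i + 5) then (f i + 1).choose δ else 0) + (if lo ≤ x i + 5 ∧ x i + 5 ≤ hi ∧ Θ ≤ (f i) + (x i + 5) then (f i).choose δ else 0) :=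
    fun n hn i _ => sum_choose_min_five_eight n hn
      (fun a b => if lo ≤ x i + a ∧ x i + a ≤ hi ∧ Θ ≤ (f i + b) + (x i + a) then (f i + b).choose δ else 0)
  have hRm : ∀ n : ℕ, 9 ≤ n → ∀ i ∈ s, ∑ j ∈ range (n + 1), Nat.choose n j *
        (if lo + δ ≤ f i + min (n - j) 5 ∧ f i + min (n - j) 5 ≤ hi + δ then (f i + min (n - j) 5).choose δ else 0) =
      (if lo + δ ≤ f i + 5 ∧ f i + 5 ≤ hi + δ then (f i + 5).choose δ else 0) + n * (if lo + δ ≤ f i + 5 ∧ f i + 5 ≤ hi + δ then (f i + 5).choose δ else 0) + n.choose 2 * (if lo + δ ≤ f i + 5 ∧ f i + 5 ≤ hi + δ then (f i + 5).choose δ else 0) + n.choose 3 * (if lo + δ ≤ f i + 5 ∧ f i + 5 ≤ hi + δ then (f i + 5).choose δ else 0) + n.choose 4 * (if lo + δ ≤ f i + 5 ∧ f i + 5 ≤ hi + δ then (f i + 5).choose δ else 0) + (∑ i ∈ Ico 5 (n - 4), n.choose i) * (if lo + δ ≤ f i + 5 ∧ f i + 5 ≤ hi + δ then (f i + 5).choose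 δ else 0) + n.choose 4 * (if lo + δ ≤ f i + 4 ∧ f i + 4 ≤ hi + δ then (f i + 4).choose δ else 0) + n.choose 3 * (if lo + δ ≤ f i + 3 ∧ f i + 3 ≤ hi + δ then (f i + 3).choose δ else 0) + n.choose 2 * (if lo + δ ≤ f i + 2 ∧ f i + 2 ≤ hi + δ then (f i + 2).choose δ else 0) + n * (if lo + δ ≤ f i + 1 ∧ f i + 1 ≤ hi + δ then (f i + 1).choose δ else 0) + (if lo + δ ≤ f i ∧ f i ≤ hi + δ then (f i).choose δ else 0) :=
    fun n hn i _ => sum_choose_min_five_eight n hn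
      (fun _ b => if lo + δ ≤ f i + b ∧ f i + b ≤ hi + δ then (f i + b).choose δ else 0)
  rw [sum_congr rfl (hLm m hm), sum_congr rfl (hRm m hm)]
  rw [sum_congr rfl (hLm 9 le_rfl), sum_congr rfl (hRm 9 le_rfl)] at h₀
  simp only [sum_add_distrib, ← mul_sum] at h₀ hq hq' hq'' ⊢
  rw [sum_add_distrib, sum_add_distrib] at hT
  -- the coefficients
  rcases Nat.eq_or_lt_of_le hm with hm0 | hm1
  · subst hm0; exact h₀
  have hm1' : 10 ≤ m := hm1
  obtain ⟨k, hk⟩ := Nat.exists_eq_add_of_le hm1'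
  obtain ⟨k', hk'⟩ := Nat.exists_eq_add_of_le (sum_choose_mid5_mono_eight 9 m hm)
  have hC2 : 24 * m.choose 2 = 1080 + 228 * k + 12 * k * k := by rw [hk]; exact choose_two_ten_eight k
  have hC3 : 24 * m.choose 3 = 2880 + 968 * k + 108 * k * k + 4 * k * k * k := by rw [hk]; exact choose_three_ten_eight k
  have hC4 : 24 * m.choose 4 = 5040 + 2414 * k + 431 * k * k + 34 * k * k * k + k * k * k * k := by rw [hk]; exact choose_four_ten_eight k
  have hm0c2 : Nat.choose 9 2 = 36 := by decide
  have hm0c3 : Nat.choose 9 3 = 84 := by decide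
  have hm0c4 : Nat.choose 9 4 = 126 := by decide
  rw [hm0c2, hm0c3, hm0c4] at h₀
  rw [hk']
  rw [hk] at hC2 hC3 hC4 ⊢
  exact lift_alg_five_eight _ _ _ _ _ _ _ _ _ _ _ _ _ _ _ _ _ _ _ _ _ _ _ _ _ _ _ _ hC2 hC3 hC4 h₀ hq hq' hq'' hT hS

end PLDFiveLift

end PercRepro
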